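import Literature.Probability.RandomPlanarGeometry.LoewnerImageCurve
import Literature.Probability.RandomPlanarGeometry.SLESixHullLocalityPullback
import Literature.Probability.RandomPlanarGeometry.StarShiftSubordination
import Literature.Probability.RandomPlanarGeometry.RadialChordalTrace
import Literature.Probability.RandomPlanarGeometry.LoewnerTraceLimit
import HarnessLib

/-!
# The conformal image of a chordal Loewner trace is the trace of the image chain

Topic `Probability/RandomPlanarGeometry`; theorems and one definition (`Loewner.clockC`).
Sequel of `LoewnerImageChain` / `LoewnerImageLifetime` / `LoewnerImageCurve` (Lawler–Schramm–Werner,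
*Conformal restriction: the chordal case*, JAMS 16 (2003), §5; G. F. Lawler (2005), Prop. 4.41):
there, for a `*`-hull `A` with reflected canonical map `E_A = starMap A` and a driving function `W`
alive at the horizon `β` (`Disjoint (closedHull W β) A`), the image maps `g̃_t = h_t ∘ g_t ∘ Φ_A⁻¹`
were identified, at the capacity times `σ t = imageClock W A t`, with the Loewner maps of the
image driving function `W̃ ∘ τ = imageDriverC W A β` (`map_imageDriverC_eq`). Here we pass to
TIPS, i.e. to generating curves (the hull analogue of `MoebiusPole.apply_clockNN_eq_of_isGeneratedByCurve`
of `SLESixMoebiusLocalityProofs.lean`, Lawler §6.3):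

* `clockC W A t = (σ t)⁺` — the capacity clock in `ℝ≥0`;
* `invFunOn_map_imageDriverC` — **the inverse image Loewner map through the original one**:
  for `t < β` and `w ∈ ℍ`, `(ĝ_{σ t})⁻¹(w) = E_A(g_t⁻¹(Φ_{B_t}⁻¹(w − W̃_t) + W_t))`, with
  `B_t = slidHull W A t` the slid hull and `Φ_{B_t} = starRMap B_t` (the image map of a point
  alive only shortly after `t` is read through a horizon between `t` and its swallowing time,
  `imageDriverC_eq_of_le`, locality of the chain in the driver `Loewner.domain_eq_of_eqOn`);
* `tendsto_preimagePoint` — `Φ_{B_t}⁻¹(w − W̃_t) + W_t → W_t` within `ℍ` as `w → W̃_t` within `ℍ`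
  (`tendsto_starRMap_symm_nhdsWithin_zero`);
* **`apply_clockC_eq_of_isGeneratedByCurve`** — if the chain of `W` is generated by `γ` and the
  chain of a continuous `U'` equal to `W̃ ∘ τ` up to `σ β₂` (`β₂ < β`) is generated by `γ̂`, then
  `γ̂ (σ t) = E_A (γ t)` for every `t ≤ β₂`: both tips are limits of the inverse maps at the driving
  values within `ℍ` (`IsGeneratedByCurve.tendsto_invFunOn_map`, Lawler Prop. 4.31 / Rem. 4.32).

References: [LSW 2003] §5; Lawler (2005), §4.6.1 Prop. 4.41, §6.3.
-/

noncomputable section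

open Set Filter Topology Function Complex Metric
open UpperHalfPlane (upperHalfPlaneSet isOpen_upperHalfPlaneSet)
open scoped NNReal

namespace Literature.Probability.RandomPlanarGeometry

namespace Loewner

variable {W : ℝ≥0 → ℝ} {A : Set ℂ}

/-! ### The capacity clock in `ℝ≥0` -/

/-- The capacity clock `σ t = imageClock W A t` as an element of `ℝ≥0`. [folklore] -/
def clockC (W : ℝ≥0 → ℝ) (A : Set ℂ) (t : ℝ≥0) : ℝ≥0 :=
  (imageClock W A t).toNNReal

section Tip

variable (hW : Continuous W) (hW0 : W 0 = 0) (hA : IsStarHull A) (hne : A.Nonempty) {β : ℝ≥0}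
  (hβ : Disjoint (closedHull W β) A)
include hW hA hne hβ

/-- `σ t ≥ 0` for `t ≤ β`, so `(clockC t : ℝ) = σ t`. [folklore] -/
theorem coe_clockC {t : ℝ≥0} (ht : t ≤ β) : (clockC W A t : ℝ) = imageClock W A t :=
  Real.coe_toNNReal _ (imageClock_mem hW hA hne hβ ⟨t.coe_nonneg, NNReal.coe_le_coe.2 ht⟩).1

/-- `clockC 0 = 0`. [folklore] -/
theorem clockC_zero : clockC W A 0 = 0 := by
  apply NNReal.eq
  rw [coe_clockC hW hA hne hβ (t := 0) bot_le, NNReal.coe_zero]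
  exact imageClock_zero W A

/-- `clockC` is strictly monotone on `[0, β]`. [folklore] -/
theorem clockC_lt_clockC {s t : ℝ≥0} (hst : s < t) (ht : t ≤ β) : clockC W A s < clockC W A t := by
  rw [← NNReal.coe_lt_coe, coe_clockC hW hA hne hβ (hst.le.trans ht), coe_clockC hW hA hne hβ ht]
  exact strictMonoOn_imageClock hW hA hne hβ ⟨s.coe_nonneg, NNReal.coe_le_coe.2 (hst.le.trans ht)⟩
    ⟨t.coe_nonneg, NNReal.coe_le_coe.2 ht⟩ (NNReal.coe_lt_coe.2 hst)

/-- `clockC` is monotone on `[0, β]`. [folklore] -/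
theorem clockC_mono {s t : ℝ≥0} (hst : s ≤ t) (ht : t ≤ β) : clockC W A s ≤ clockC W A t := by
  rcases hst.eq_or_lt with rfl | hlt
  · exact le_rfl
  · exact (clockC_lt_clockC hW hA hne hβ hlt ht).le

/-- `τ (σ t) = t` in `ℝ≥0`, for `t ≤ β`. [folklore] -/
theorem toNNReal_imageClockInv_clockC {t : ℝ≥0} (ht : t ≤ β) :
    (imageClockInv W A β (clockC W A t)).toNNReal = t := by
  rw [coe_clockC hW hA hne hβ ht,
    imageClockInv_imageClock hW hA hne hβ ⟨t.coe_nonneg, NNReal.coe_le_coe.2 ht⟩, Real.toNNReal_coe]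

/-- The image driving value at `σ t` is `W̃_t = imageDriver W A t`, for `t ≤ β`. [folklore] -/
theorem imageDriverC_clockC {t : ℝ≥0} (ht : t ≤ β) :
    imageDriverC W A β (clockC W A t) = imageDriver W A t := by
  have hq : (clockC W A t : ℝ) ∈ Icc (0 : ℝ) (imageClock W A β) := by
    rw [coe_clockC hW hA hne hβ ht]
    exact ⟨(imageClock_mem hW hA hne hβ ⟨t.coe_nonneg, NNReal.coe_le_coe.2 ht⟩).1,
      (strictMonoOn_imageClock hW hA hne hβ).monotoneOn ⟨t.coe_nonneg, NNReal.coe_le_coe.2 ht⟩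
        ⟨β.coe_nonneg, le_rfl⟩ (NNReal.coe_le_coe.2 ht)⟩
  have := imageDriverC_toNNReal (W := W) (A := A) hq
  rw [Real.toNNReal_coe] at this
  rw [this, toNNReal_imageClockInv_clockC hW hA hne hβ ht]

/-- `u ↦ clockC u` is continuous on `[0, β]` (as a function on `ℝ≥0`, continuous at every
`t ≤ β` within `Iic β`); we record the form used downstream: continuity of
`r ↦ clockC (r⁺ ∧ β)`-free statement `ContinuousOn`. [folklore] -/
theorem continuousOn_clockC : ContinuousOn (fun t : ℝ≥0 ↦ clockC W A t) (Iic β) := by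
  have h1 : ContinuousOn (fun t : ℝ≥0 ↦ imageClock W A t) (Iic β) :=
    (continuousOn_imageClock hW hA hne hβ).comp NNReal.continuous_coe.continuousOn
      fun t ht ↦ ⟨t.coe_nonneg, NNReal.coe_le_coe.2 ht⟩
  exact continuous_real_toNNReal.comp_continuousOn h1

/-! ### A horizon between a time and the swallowing time of a point -/

omit hW hA hne hβ in
/-- Between `t < β` and the swallowing time of a point alive beyond `t` there is a horizon.
[folklore] -/
theorem exists_horizon {t : ℝ≥0} {z : ℂ} (htz : (t : WithTop ℝ≥0) < swallowingTime W z)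
    (htβ : t < β) : ∃ β' : ℝ≥0, t < β' ∧ β' ≤ β ∧ (β' : WithTop ℝ≥0) < swallowingTime W z := by
  rcases eq_or_ne (swallowingTime W z) ⊤ with htop | hfin
  · exact ⟨β, htβ, le_rfl, by rw [htop]; exact WithTop.coe_lt_top _⟩
  · obtain ⟨s, hs⟩ := WithTop.ne_top_iff_exists.1 hfin
    rw [← hs] at htz ⊢
    have hts : t < s := WithTop.coe_lt_coe.1 htz
    refine ⟨min β ((t + s) / 2), lt_min htβ ?_, min_le_left _ _, ?_⟩
    · rw [← NNReal.coe_lt_coe, NNReal.coe_div, NNReal.coe_add]; push_cast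
      have := NNReal.coe_lt_coe.2 hts; linarith
    · refine WithTop.coe_lt_coe.2 (lt_of_le_of_lt (min_le_right _ _) ?_)
      rw [← NNReal.coe_lt_coe, NNReal.coe_div, NNReal.coe_add]; push_cast
      have := NNReal.coe_lt_coe.2 hts; linarith

/-! ### The inverse image Loewner map through the original one -/

omit hne in
/-- The point of the original chain over an image point `w ∈ ℍ` at time `t`:
`x(w) = Φ_{B_t}⁻¹(w − W̃_t) + W_t` (`B_t` the slid hull, alive at `t`). [folklore] -/
theorem preimagePoint_mem {t : ℝ≥0} (ht : t ≤ β) {w : ℂ} (hw : w ∈ upperHalfPlaneSet) :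
    ((starRMap (slidHull W A t) (isStarHull_slidHull_of_disjoint hW hA (alive_mono ht hβ))).symm
        (w - imageDriver W A t)) ∈ upperHalfPlaneSet \ slidHull W A t := by
  refine (starRMap _ _).symm.mapsTo ?_
  show 0 < (w - (imageDriver W A t : ℂ)).im
  rw [sub_im, ofReal_im, sub_zero]; exact hw

/-- **The inverse image Loewner map through the original one**: for `t < β` and `w ∈ ℍ`,
`(ĝ_{σ t})⁻¹(w) = E_A(g_t⁻¹(Φ_{B_t}⁻¹(w − W̃_t) + W_t))`, the inverses read as `Function.invFunOn`
on the Loewner domains. [cite: LawlerSchrammWerner2003Restriction, §5] -/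
theorem invFunOn_map_imageDriverC (hW0 : W 0 = 0) {t : ℝ≥0} (ht : t < β) {w : ℂ}
    (hw : w ∈ upperHalfPlaneSet) :
    invFunOn (map (imageDriverC W A β) (clockC W A t)) (domain (imageDriverC W A β) (clockC W A t)) w =
      starMap A (invFunOn (map W t) (domain W t)
        ((starRMap (slidHull W A t) (isStarHull_slidHull_of_disjoint hW hA (alive_mono ht.le hβ))).symm
          (w - imageDriver W A t) + W t)) := by
  set B := slidHull W A t with hBdef
  have hB : IsStarHull B := isStarHull_slidHull_of_disjoint hW hA (alive_mono ht.le hβ)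
  set ΦB := starRMap B hB with hΦB
  set q : ℝ≥0 := clockC W A t with hqdef
  set c : ℝ := imageDriver W A t with hcdef
  -- the preimage point and the original point
  set y := ΦB.symm (w - c) with hydef
  have hy : y ∈ upperHalfPlaneSet \ B := preimagePoint_mem hW hA hβ ht.le hw
  set x := y + W t with hxdef
  have hx : x ∈ upperHalfPlaneSet := by
    show 0 < (y + (W t : ℂ)).im
    rw [add_im, ofReal_im, add_zero]; exact hy.1
  set z := invFunOn (map W t) (domain W t) x with hzdef
  have hex : ∃ z' ∈ domain W t, map W t z' = x := (surjOn_map hW t) hx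
  have hzdom : z ∈ domain W t := invFunOn_mem hex
  have hzeq : map W t z = x := invFunOn_eq hex
  obtain ⟨hzH, hzt⟩ := (mem_domain_iff W t z).1 hzdom
  have hzA : z ∉ A := fun hzA ↦ hy.2 ⟨z, hzA, by
    show map W t z - W t = y
    rw [hzeq, hxdef, add_sub_cancel_right]⟩
  have hz0 : z ≠ 0 := fun h ↦ by
    have h' : 0 < z.im := hzH
    rw [h, Complex.zero_im] at h'
    exact lt_irrefl _ h'
  -- a horizon between `t` and the swallowing time of `z`
  obtain ⟨β', htβ', hβ'β, hzβ'⟩ := exists_horizon (W := W) hzt ht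
  have hβ' : Disjoint (closedHull W β') A := alive_mono hβ'β hβ
  -- clock facts at the horizon `β'`
  have htI : (t : ℝ) ∈ Icc (0 : ℝ) β' := ⟨t.coe_nonneg, NNReal.coe_le_coe.2 htβ'.le⟩
  have hqσ : (q : ℝ) = imageClock W A t := coe_clockC hW hA hne hβ ht.le
  have hq' : (q : ℝ) < imageClock W A β' := by
    rw [hqσ]
    exact strictMonoOn_imageClock hW hA hne hβ' htI ⟨β'.coe_nonneg, le_rfl⟩ (NNReal.coe_lt_coe.2 htβ')
  have hτ' : (imageClockInv W A β' q).toNNReal = t := by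
    rw [hqσ, imageClockInv_imageClock hW hA hne hβ' htI, Real.toNNReal_coe]
  -- the image point `E_A z` is in the image domain and is sent to `w`
  have hEz : imageFlow W A 0 z = starMap A z := imageFlow_zero hW hW0 hA hz0
  have hEzH : 0 < (starMap A z).im := starMap_mem_of_mem_diff hA ⟨hzH, hzA⟩
  have hmem' : starMap A z ∈ domain (imageDriverC W A β') q := by
    have := imageFlow_zero_mem_domain hW hA hne hβ' hzH hzA hzβ' hq' (by rw [hEz]; exact hEzH)
    rwa [hEz] at this
  have hmap' : map (imageDriverC W A β') q (starMap A z) = w := by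
    have h1 := map_imageDriverC_eq hW hA hne hβ' hzH hzA hzβ' hq'
    rw [hEz] at h1
    rw [h1, imageFlowC, hτ', imageFlow]
    have hyz : map W t z - W t = y := by rw [hzeq, hxdef, add_sub_cancel_right]
    have hwc : w - (c : ℂ) ∈ upperHalfPlaneSet := by
      show 0 < (w - (c : ℂ)).im
      rw [sub_im, ofReal_im, sub_zero]; exact hw
    rw [hyz, starMap_of_mem_diff hB hy, hydef, ConformalEquiv.apply_symm_apply _ hwc, hcdef, imageDriver]
    apply Complex.ext
    · simp only [sub_re, add_re, ofReal_re]
      ring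
    · simp only [sub_im, add_im, ofReal_im, starShift_im_eq_zero]
      ring
  -- transfer to the horizon `β` (locality of the chain in the driver)
  have hUc := continuous_imageDriverC hW hA hne hβ
  have hUc' := continuous_imageDriverC hW hA hne hβ'
  have heqd : ∀ s, s ≤ q → imageDriverC W A β' s = imageDriverC W A β s := fun s hs ↦ by
    have hsI : (s : ℝ) ∈ Icc (0 : ℝ) (imageClock W A β') :=
      ⟨s.coe_nonneg, (NNReal.coe_le_coe.2 hs).trans hq'.le⟩
    have := imageDriverC_eq_of_le hW hA hne hβ hβ'β hsI
    rwa [Real.toNNReal_coe] at this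
  have hdom : domain (imageDriverC W A β) q = domain (imageDriverC W A β') q :=
    Loewner.domain_eq_of_eqOn hUc' hUc heqd
  have hmem : starMap A z ∈ domain (imageDriverC W A β) q := by rw [hdom]; exact hmem'
  have hmap : map (imageDriverC W A β) q (starMap A z) = w := by
    rw [Loewner.map_eq_of_eqOn hUc' hUc heqd ((mem_domain_iff _ _ _).1 hmem').2 le_rfl]
    exact hmap'
  -- conclude by injectivity of the image map on its domain
  have hex'' : ∃ z' ∈ domain (imageDriverC W A β) q, map (imageDriverC W A β) q z' = w :=
    ⟨_, hmem, hmap⟩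
  exact (injOn_map hUc q) (invFunOn_mem hex'') hmem ((invFunOn_eq hex'').trans hmap.symm)

omit hne in
/-- **`x(w) → W_t` within `ℍ` as `w → W̃_t` within `ℍ`** (`Φ_B⁻¹ → 0` at `0`,
`tendsto_starRMap_symm_nhdsWithin_zero`). [folklore] -/
theorem tendsto_preimagePoint {t : ℝ≥0} (ht : t ≤ β) :
    Tendsto (fun w : ℂ ↦ (starRMap (slidHull W A t)
        (isStarHull_slidHull_of_disjoint hW hA (alive_mono ht hβ))).symm (w - imageDriver W A t) + W t)
      (𝓝[upperHalfPlaneSet] (imageDriver W A t : ℂ)) (𝓝[upperHalfPlaneSet] (W t : ℂ)) := by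
  set B := slidHull W A t with hBdef
  have hB : IsStarHull B := isStarHull_slidHull_of_disjoint hW hA (alive_mono ht hβ)
  set c : ℝ := imageDriver W A t with hcdef
  -- `w - c → 0` within `ℍ`
  have h1 : Tendsto (fun w : ℂ ↦ w - (c : ℂ)) (𝓝[upperHalfPlaneSet] (c : ℂ))
      (𝓝[upperHalfPlaneSet] 0) := by
    refine tendsto_nhdsWithin_iff.2 ⟨?_, eventually_nhdsWithin_of_forall fun w hw ↦ ?_⟩
    · have : Tendsto (fun w : ℂ ↦ w - (c : ℂ)) (𝓝 (c : ℂ)) (𝓝 ((c : ℂ) - c)) :=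
        (continuous_sub_right (c : ℂ)).tendsto (c : ℂ)
      rw [sub_self] at this
      exact this.mono_left nhdsWithin_le_nhds
    · show 0 < (w - (c : ℂ)).im
      rw [sub_im, ofReal_im, sub_zero]; exact hw
  -- `Φ_B⁻¹ → 0` within `ℍ`, with values in `ℍ`
  have h2 : Tendsto (starRMap B hB).symm (𝓝[upperHalfPlaneSet] 0) (𝓝[upperHalfPlaneSet] 0) :=
    tendsto_nhdsWithin_iff.2 ⟨tendsto_starRMap_symm_nhdsWithin_zero hB,
      eventually_nhdsWithin_of_forall fun w hw ↦ ((starRMap B hB).symm.mapsTo hw).1⟩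
  -- add `W_t`
  have h3 : Tendsto (fun y : ℂ ↦ y + (W t : ℂ)) (𝓝[upperHalfPlaneSet] 0)
      (𝓝[upperHalfPlaneSet] (W t : ℂ)) := by
    refine tendsto_nhdsWithin_iff.2 ⟨?_, eventually_nhdsWithin_of_forall fun y hy ↦ ?_⟩
    · have : Tendsto (fun y : ℂ ↦ y + (W t : ℂ)) (𝓝 0) (𝓝 ((0 : ℂ) + W t)) :=
        (continuous_add_const (W t : ℂ)).tendsto (0 : ℂ)
      rw [zero_add] at this
      exact this.mono_left nhdsWithin_le_nhds
    · show 0 < (y + (W t : ℂ)).im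
      rw [add_im, ofReal_im, add_zero]; exact hy
  exact h3.comp (h2.comp h1)

/-! ### The image of the trace is the trace of the image chain -/

variable {U' : ℝ≥0 → ℝ} (hU' : Continuous U') {β₂ : ℝ≥0} (hβ₂ : β₂ < β)
  (hagree : ∀ s, s ≤ clockC W A β₂ → U' s = imageDriverC W A β s)
include hU' hβ₂ hagree

omit hU' in
/-- Agreement up to `σ β₂` gives agreement up to `σ t` for `t ≤ β₂`. [folklore] -/
theorem eqOn_of_le {t : ℝ≥0} (ht : t ≤ β₂) :
    ∀ s, s ≤ clockC W A t → imageDriverC W A β s = U' s := fun s hs ↦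
  (hagree s (hs.trans (clockC_mono hW hA hne hβ ht hβ₂.le))).symm

/-- **The image of the trace is the trace of the image chain.** Let the chain of `W` be
generated by `γ` and the chain of `U'` (continuous, equal to the image driver `W̃ ∘ τ` up to
`σ β₂`, `β₂ < β`) by `γ̂`. Then `γ̂ (σ t) = E_A (γ t)` for every `t ≤ β₂`: both tips are limits
of the inverse maps at the driving values within `ℍ` (`IsGeneratedByCurve.tendsto_invFunOn_map`),
the inverse maps are intertwined by `E_A` and `x(·)` (`invFunOn_map_imageDriverC`,
`Loewner.invFunOn_map_eq_of_eqOn`), and `x(w) → W_t` within `ℍ` at `U'_{σ t} = W̃_t`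
(`tendsto_preimagePoint`). [cite: LawlerSchrammWerner2003Restriction, §5; Lawler2005, Prop. 4.41] -/
theorem apply_clockC_eq_of_isGeneratedByCurve (hW0 : W 0 = 0) {γ γ' : ℝ≥0 → ℂ}
    (hγ : IsGeneratedByCurve W γ) (hγ' : IsGeneratedByCurve U' γ') {t : ℝ≥0} (ht : t ≤ β₂) :
    γ' (clockC W A t) = starMap A (γ t) := by
  have hUc := continuous_imageDriverC hW hA hne hβ
  have htβ : t < β := lt_of_le_of_lt ht hβ₂
  set q := clockC W A t with hq
  have heq := eqOn_of_le hW hA hne hβ hβ₂ hagree ht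
  -- the driving value of `U'` at `q` is `W̃_t`
  have hUq : U' q = imageDriver W A t := by
    rw [← heq q le_rfl, hq, imageDriverC_clockC hW hA hne hβ htβ.le]
  -- tip of the `U'`-chain at `q`
  have htip' := hγ'.tendsto_invFunOn_map hU' q
  rw [hUq] at htip'
  -- the inverse `U'`-map is the inverse image map
  have hev : ∀ w ∈ upperHalfPlaneSet, invFunOn (map U' q) (domain U' q) w =
      starMap A (invFunOn (map W t) (domain W t)
        ((starRMap (slidHull W A t) (isStarHull_slidHull_of_disjoint hW hA (alive_mono htβ.le hβ))).symm
          (w - imageDriver W A t) + W t)) := by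
    intro w hw
    rw [Loewner.invFunOn_map_eq_of_eqOn hUc hU' heq hw, invFunOn_map_imageDriverC hW hA hne hβ hW0 htβ hw]
  -- the composite limit
  have hγt : γ t ∉ A := hγ.apply_notMem_of_alive hW (alive_mono htβ.le hβ) le_rfl
  have hlim : Tendsto (fun w ↦ starMap A (invFunOn (map W t) (domain W t)
      ((starRMap (slidHull W A t) (isStarHull_slidHull_of_disjoint hW hA (alive_mono htβ.le hβ))).symm
        (w - imageDriver W A t) + W t)))
      (𝓝[upperHalfPlaneSet] (imageDriver W A t : ℂ)) (𝓝 (starMap A (γ t))) := by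
    have h1 := tendsto_preimagePoint hW hA hβ htβ.le
    have h2 := (hγ.tendsto_invFunOn_map hW t).comp h1
    exact ((continuousAt_starMap hA (hγ.im_nonneg t) hγt).tendsto).comp h2
  have hlim' : Tendsto (invFunOn (map U' q) (domain U' q))
      (𝓝[upperHalfPlaneSet] (imageDriver W A t : ℂ)) (𝓝 (starMap A (γ t))) :=
    hlim.congr' (eventually_nhdsWithin_of_forall fun w hw ↦ (hev w hw).symm)
  haveI : (𝓝[upperHalfPlaneSet] ((imageDriver W A t : ℝ) : ℂ)).NeBot :=
    mem_closure_iff_nhdsWithin_neBot.1 (mem_closure_upperHalfPlaneSet_iff.2 (by rw [ofReal_im]))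
  exact tendsto_nhds_unique htip' hlim'

end Tip

end Loewner

end Literature.Probability.RandomPlanarGeometry

end
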